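import Mathlib
import Summits.MatrixMultiplication.MatrixMultiplication.Theses.FidelityWitnesses
import Summits.MatrixMultiplication.MatrixMultiplication.Theorems.FidelityWitnessesDiagonalPowerDecayStubVertexRankLaw
import Literature.Computability.AlgebraicComplexity.TensorRestrictionRank
import Literature.Computability.AlgebraicComplexity.GroupAlgebraTensor

/-!
# Block self-similarity: uniform capture bounds at budget `n²` ARE superlinear rank lower bounds

Crux `FidelityWitnesses.DiagonalPowerDecay` (stmt-MatrixMultiplication-14053), lead c4, `--supports`.
`T_n = matMulTensor ℂ n n n` (`‖T_n‖² = n³`); the CAPTURE of `S ≠ 0` is `|⟨S,T_n⟩|²/‖S‖²`, `φ(n) = M(n,n²)/n³`.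

THE DICTIONARY (item (1) of the crux docstring, "block self-similarity", made kernel-exact and uniform in the number of
blocks `K`).  In the format `n = K·m` let `D` be the diagonal `0/1` matrix on the vertex space `(Fin n)³` supported on the
triples whose coordinates lie in ONE block of `Fin (K·m) ≃ Fin K × Fin m` (`finProdFinEquiv`; block index
`(finProdFinEquiv.symm x).1`).  Its vertex un-flattening `♯D` (`♯X (a,b,c) = X (a.1,b.2,c.2) (b.1,c.1,a.2)`; dictionary
`vrl_capture_eq_trace` / `vrl_normSq_eq`) is the BLOCK-DIAGONAL matrix multiplication (`K` padded copies of `⟨m,m,m⟩`):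
`R(♯D) ≤ K·R(⟨m,m,m⟩)` (each block a restriction of `⟨m,m,m⟩`, `bss_block_restrictsTo`, + subadditivity) and
`⟨♯D,T_n⟩ = tr D = ‖D‖_F² = ‖♯D‖² = K·m³`.  Hence **`R(⟨m,m,m⟩) ≤ K·m² ⟹ φ(K·m) ≥ 1/K²`**
(`exists_capture_of_tensorRank_le`) and **a uniform bound `φ(K·m) ≤ c`, `c·K² < 1`, forces `R(⟨m,m,m⟩) > K·m²`**
(`tensorRank_matMul_gt_of_capture_le`).

CONSEQUENCES.  (1) Even QUALITATIVE decay `φ(n) → 0` (no rate, no constant: the weakest member of the crux family, and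
consistent with `ω(ℂ) = 2`, unlike the crux) forces `R(⟨m,m,m⟩)/m² → ∞` (`superlinear_tensorRank_of_qualitativeDecay`) —
a superlinear tensor-rank lower bound for matrix multiplication, open since 1969 (printed frontier `3m² − o(m²)`,
Landsberg 2014 / Massarenti–Raviolo 2013).  The crux gives it a fortiori (`qualitativeDecay_of_diagonalPowerDecay`,
`superlinear_tensorRank_of_diagonalPowerDecay`; sharper for the power scale: the landed `dpdGlue_two_lt_omega`).
(2) Calibration `c < 1/K² ↦ R(⟨m,m,m⟩) > K·m²`: `c < 1/4` at `n = 2m` re-proves `> 2m²`, `c < 1/9` at `n = 3m` gives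
`> 3m²`, beyond the frontier; the only n-uniform bound known is `c = 5/6` (`koszulWitness`, lead c3) and linear rank
methods cannot go below `1/6 > 1/9` — no witness of the route's class reaches the regime where capture says something new
about rank.  Mathlib + landed `vrl_*` + Literature (`TensorRestrictsTo`, `tensorRank_sum_le`); no new definitions.
-/

set_option linter.dupNamespace false

namespace Summit.MatrixMultiplication.MatrixMultiplication.Theorems.DiagonalPowerDecay

open scoped BigOperators
open Filter
open Literature.Computability.AlgebraicComplexity
open Summit.MatrixMultiplication.MatrixMultiplication.Theses.FidelityWitnesses (DiagonalPowerDecay)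

/-! ## Blocks of `Fin (K·m)` -/

/-- The block index of the embedded point `(i, j)` is `i`. [folklore] -/
theorem bss_fst_symm_apply {K m : ℕ} (i : Fin K) (j : Fin m) :
    (finProdFinEquiv.symm (finProdFinEquiv (i, j))).1 = i := by
  rw [Equiv.symm_apply_apply]

/-- Every point is the embedding of (its block index, its offset). [folklore] -/
theorem bss_apply_symm {K m : ℕ} (x : Fin (K * m)) :
    finProdFinEquiv ((finProdFinEquiv.symm x).1, (finProdFinEquiv.symm x).2) = x := by
  rw [Prod.mk.eta, Equiv.apply_symm_apply]

/-- A pair of points of block `i` is the image of a pair of offsets under the block-`i` embedding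
`p ↦ (e (i,p.1), e (i,p.2))`. [folklore] -/
theorem bss_exists_pair_of_blocks {K m : ℕ} (i : Fin K) (w : Fin (K * m) × Fin (K * m))
    (h1 : (finProdFinEquiv.symm w.1).1 = i) (h2 : (finProdFinEquiv.symm w.2).1 = i) :
    ∃ p : Fin m × Fin m, (finProdFinEquiv (i, p.1), finProdFinEquiv (i, p.2)) = w := by
  refine ⟨((finProdFinEquiv.symm w.1).2, (finProdFinEquiv.symm w.2).2), ?_⟩
  ext1
  · simp only
    rw [← h1, bss_apply_symm]
  · simp only
    rw [← h2, bss_apply_symm]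

/-! ## One block: the zero-padded `⟨m,m,m⟩` on block `i` is a restriction of `⟨m,m,m⟩` -/

/-- **The `i`-th diagonal block is a restriction of `⟨m,m,m⟩`.**  With `Dᵢ` the diagonal `0/1` matrix on `(Fin n)³`
(`n = K·m`) supported on the triples with all three coordinates in block `i`, the tensor `♯Dᵢ` is
`⟨m,m,m⟩ ∘ (E × E × E)` zero-padded along the pair embedding `E p = (e (i,p.1), e (i,p.2))`, i.e. it is in restriction
normal form `♯Dᵢ x y z = Σ_{a b c} [E a = x]·[E b = y]·[E c = z]·⟨m,m,m⟩_{a b c}` (Bläser 2013 Def. 7.2). [folklore] -/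
theorem bss_block_restrictsTo {K m : ℕ} (i : Fin K) :
    TensorRestrictsTo (matMulTensor ℂ m m m)
      (fun a b c : Fin (K * m) × Fin (K * m) =>
        Matrix.diagonal (fun v : Fin (K * m) × Fin (K * m) × Fin (K * m) =>
          if (finProdFinEquiv.symm v.1).1 = i ∧ (finProdFinEquiv.symm v.2.1).1 = i ∧
              (finProdFinEquiv.symm v.2.2).1 = i then (1 : ℂ) else 0)
          (a.1, b.2, c.2) (b.1, c.1, a.2)) := by
  classical
  -- the embedding of index pairs of block `i`
  set E : Fin m × Fin m → Fin (K * m) × Fin (K * m) :=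
    fun p => (finProdFinEquiv (i, p.1), finProdFinEquiv (i, p.2)) with hE
  have hEq : ∀ p q : Fin m × Fin m, E p = E q ↔ p = q := by
    intro p q
    simp only [hE, Prod.mk.injEq, EmbeddingLike.apply_eq_iff_eq, true_and]
    exact Iff.symm Prod.ext_iff
  have hEinj : Function.Injective E := fun p q h => (hEq p q).1 h
  refine ⟨fun x a => if E a = x then 1 else 0, fun y b => if E b = y then 1 else 0,
    fun z c => if E c = z then 1 else 0, fun x y z => ?_⟩
  dsimp only
  -- the right-hand side vanishes unless all three indices are in the image of `E`
  have hRHS_off : ¬ ((∃ a, E a = x) ∧ (∃ b, E b = y) ∧ (∃ c, E c = z)) →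
      (∑ a : Fin m × Fin m, ∑ b : Fin m × Fin m, ∑ c : Fin m × Fin m,
        (if E a = x then (1 : ℂ) else 0) * (if E b = y then (1 : ℂ) else 0) *
        (if E c = z then (1 : ℂ) else 0) * matMulTensor ℂ m m m a b c) = 0 := by
    intro hoff
    refine Finset.sum_eq_zero fun a _ => Finset.sum_eq_zero fun b _ =>
      Finset.sum_eq_zero fun c _ => ?_
    by_cases ha : E a = x
    · by_cases hb : E b = y
      · have hc : E c ≠ z := fun hc => hoff ⟨⟨a, ha⟩, ⟨b, hb⟩, ⟨c, hc⟩⟩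
        simp [hc]
      · simp [hb]
    · simp [ha]
  -- the left-hand side vanishes unless all three indices are in the image of `E`
  have hLHS_off : Matrix.diagonal (fun v : Fin (K * m) × Fin (K * m) × Fin (K * m) =>
      if (finProdFinEquiv.symm v.1).1 = i ∧ (finProdFinEquiv.symm v.2.1).1 = i ∧
        (finProdFinEquiv.symm v.2.2).1 = i then (1 : ℂ) else 0) (x.1, y.2, z.2) (y.1, z.1, x.2) ≠ 0 →
      (∃ a, E a = x) ∧ (∃ b, E b = y) ∧ (∃ c, E c = z) := by
    rw [Matrix.diagonal_apply]
    split_ifs with heq hblk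
    · intro _
      simp only [Prod.mk.injEq] at heq
      exact ⟨bss_exists_pair_of_blocks i x hblk.1 (by rw [← heq.2.2]; exact hblk.2.2),
        bss_exists_pair_of_blocks i y (by rw [← heq.1]; exact hblk.1) hblk.2.1,
        bss_exists_pair_of_blocks i z (by rw [← heq.2.1]; exact hblk.2.1) hblk.2.2⟩
    · simp
    · simp
  by_cases hall : (∃ a, E a = x) ∧ (∃ b, E b = y) ∧ (∃ c, E c = z)
  · -- on the image: both sides are `⟨m,m,m⟩_{a₀ b₀ c₀}`
    obtain ⟨⟨a₀, rfl⟩, ⟨b₀, rfl⟩, ⟨c₀, rfl⟩⟩ := hall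
    simp only [hEinj.eq_iff]
    rw [Finset.sum_eq_single a₀ (fun a _ ha => by simp [ha]) (by simp),
      Finset.sum_eq_single b₀ (fun b _ hb => by simp [hb]) (by simp),
      Finset.sum_eq_single c₀ (fun c _ hc => by simp [hc]) (by simp), Matrix.diagonal_apply]
    simp only [hE, Prod.mk.injEq, EmbeddingLike.apply_eq_iff_eq, true_and, bss_fst_symm_apply,
      and_self, if_true, matMulTensor, one_mul]
    by_cases h : a₀.1 = b₀.1 ∧ b₀.2 = c₀.1 ∧ a₀.2 = c₀.2
    · rw [if_pos h, if_pos ⟨h.1, h.2.1, h.2.2.symm⟩]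
    · rw [if_neg h, if_neg]
      rintro ⟨h1, h2, h3⟩
      exact h ⟨h1, h2, h3.symm⟩
  · rw [hRHS_off hall]
    by_contra hne
    exact hall (hLHS_off hne)

/-- `R(♯Dᵢ) ≤ R(⟨m,m,m⟩)` for every block `i` (restriction is rank-monotone, Bläser 2013 Lemma 5.4). [folklore] -/
theorem bss_tensorRank_block_le {K m : ℕ} (i : Fin K) :
    tensorRank (fun a b c : Fin (K * m) × Fin (K * m) =>
        Matrix.diagonal (fun v : Fin (K * m) × Fin (K * m) × Fin (K * m) =>
          if (finProdFinEquiv.symm v.1).1 = i ∧ (finProdFinEquiv.symm v.2.1).1 = i ∧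
              (finProdFinEquiv.symm v.2.2).1 = i then (1 : ℂ) else 0)
          (a.1, b.2, c.2) (b.1, c.1, a.2)) ≤ tensorRank (matMulTensor ℂ m m m) :=
  (bss_block_restrictsTo i).tensorRank_le

/-! ## The block-diagonal projector `D = Σᵢ Dᵢ` and its un-flattening `♯D` -/

/-- `♯D = Σᵢ ♯Dᵢ`: the "same block" indicator is the sum over `i` of the "all in block `i`" indicators. [folklore] -/
theorem bss_blockDiag_eq_sum {K m : ℕ} :
    (fun a b c : Fin (K * m) × Fin (K * m) =>
        Matrix.diagonal (fun v : Fin (K * m) × Fin (K * m) × Fin (K * m) =>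
          if (finProdFinEquiv.symm v.1).1 = (finProdFinEquiv.symm v.2.1).1 ∧
              (finProdFinEquiv.symm v.2.1).1 = (finProdFinEquiv.symm v.2.2).1 then (1 : ℂ) else 0)
          (a.1, b.2, c.2) (b.1, c.1, a.2)) =
      ∑ i : Fin K, fun a b c : Fin (K * m) × Fin (K * m) =>
        Matrix.diagonal (fun v : Fin (K * m) × Fin (K * m) × Fin (K * m) =>
          if (finProdFinEquiv.symm v.1).1 = i ∧ (finProdFinEquiv.symm v.2.1).1 = i ∧
              (finProdFinEquiv.symm v.2.2).1 = i then (1 : ℂ) else 0)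
          (a.1, b.2, c.2) (b.1, c.1, a.2) := by
  classical
  funext a b c
  rw [Finset.sum_apply, Finset.sum_apply, Finset.sum_apply]
  simp only [Matrix.diagonal_apply]
  by_cases heq : (a.1, b.2, c.2) = (b.1, c.1, a.2)
  · simp only [if_pos heq]
    -- the diagonal value: `[same block] = Σᵢ [all three in block i]`
    by_cases hP : (finProdFinEquiv.symm a.1).1 = (finProdFinEquiv.symm b.2).1 ∧
        (finProdFinEquiv.symm b.2).1 = (finProdFinEquiv.symm c.2).1
    · rw [if_pos hP, Finset.sum_eq_single (finProdFinEquiv.symm a.1).1]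
      · rw [if_pos ⟨rfl, hP.1.symm, (hP.1.trans hP.2).symm⟩]
      · intro i _ hi
        rw [if_neg]
        rintro ⟨h1, -, -⟩
        exact hi h1.symm
      · intro h
        exact absurd (Finset.mem_univ _) h
    · rw [if_neg hP]
      symm
      refine Finset.sum_eq_zero fun i _ => ?_
      rw [if_neg]
      rintro ⟨h1, h2, h3⟩
      exact hP ⟨h1.trans h2.symm, h2.trans h3.symm⟩
  · simp only [if_neg heq]
    exact Finset.sum_const_zero.symm

/-- **Rank of the block-diagonal tensor**: `R(♯D) ≤ K · R(⟨m,m,m⟩)` (subadditivity over the `K` blocks,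
`tensorRank_sum_le`, and `bss_tensorRank_block_le`). [folklore] -/
theorem bss_tensorRank_blockDiag_le {K m : ℕ} :
    tensorRank (fun a b c : Fin (K * m) × Fin (K * m) =>
        Matrix.diagonal (fun v : Fin (K * m) × Fin (K * m) × Fin (K * m) =>
          if (finProdFinEquiv.symm v.1).1 = (finProdFinEquiv.symm v.2.1).1 ∧
              (finProdFinEquiv.symm v.2.1).1 = (finProdFinEquiv.symm v.2.2).1 then (1 : ℂ) else 0)
          (a.1, b.2, c.2) (b.1, c.1, a.2)) ≤ K * tensorRank (matMulTensor ℂ m m m) := by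
  rw [bss_blockDiag_eq_sum]
  refine ((tensorRank_sum_le _ _).trans (Finset.sum_le_sum fun i _ => bss_tensorRank_block_le i)).trans ?_
  simp

/-- **Counting the same-block triples**: `#{v ∈ (Fin (K·m))³ : blk v₁ = blk v₂ = blk v₃} = K·m³` (the image of
`Fin K × (Fin m)³` under `(i,a,b,c) ↦ (e(i,a), e(i,b), e(i,c))`). [folklore] -/
theorem bss_card_sameBlock {K m : ℕ} :
    (Finset.univ.filter fun v : Fin (K * m) × Fin (K * m) × Fin (K * m) =>
      (finProdFinEquiv.symm v.1).1 = (finProdFinEquiv.symm v.2.1).1 ∧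
        (finProdFinEquiv.symm v.2.1).1 = (finProdFinEquiv.symm v.2.2).1).card = K * m ^ 3 := by
  classical
  set e4 : Fin K × Fin m × Fin m × Fin m → Fin (K * m) × Fin (K * m) × Fin (K * m) :=
    fun q => (finProdFinEquiv (q.1, q.2.1), finProdFinEquiv (q.1, q.2.2.1), finProdFinEquiv (q.1, q.2.2.2))
    with he4
  have hinj : Function.Injective e4 := by
    intro q q' hq
    simp only [he4, Prod.mk.injEq, EmbeddingLike.apply_eq_iff_eq] at hq
    obtain ⟨⟨h1, h2⟩, ⟨-, h3⟩, ⟨-, h4⟩⟩ := hq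
    ext <;> simp [h1, h2, h3, h4]
  have hset : (Finset.univ.filter fun v : Fin (K * m) × Fin (K * m) × Fin (K * m) =>
      (finProdFinEquiv.symm v.1).1 = (finProdFinEquiv.symm v.2.1).1 ∧
        (finProdFinEquiv.symm v.2.1).1 = (finProdFinEquiv.symm v.2.2).1) = Finset.univ.image e4 := by
    ext v
    simp only [Finset.mem_filter, Finset.mem_univ, true_and, Finset.mem_image]
    constructor
    · rintro ⟨h12, h23⟩
      refine ⟨((finProdFinEquiv.symm v.1).1, (finProdFinEquiv.symm v.1).2,
        (finProdFinEquiv.symm v.2.1).2, (finProdFinEquiv.symm v.2.2).2), ?_⟩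
      simp only [he4]
      ext1
      · exact bss_apply_symm v.1
      · ext1
        · simp only
          rw [h12, bss_apply_symm]
        · simp only
          rw [h12, h23, bss_apply_symm]
    · rintro ⟨q, rfl⟩
      simp [he4]
  rw [hset, Finset.card_image_of_injective _ hinj, Finset.card_univ]
  simp only [Fintype.card_prod, Fintype.card_fin]
  ring

/-- **Trace of the block-diagonal projector**: `tr D = K·m³`. [folklore] -/
theorem bss_trace_blockDiag {K m : ℕ} :
    (Matrix.diagonal (fun v : Fin (K * m) × Fin (K * m) × Fin (K * m) =>
        if (finProdFinEquiv.symm v.1).1 = (finProdFinEquiv.symm v.2.1).1 ∧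
            (finProdFinEquiv.symm v.2.1).1 = (finProdFinEquiv.symm v.2.2).1 then (1 : ℂ) else 0)).trace =
      ((K * m ^ 3 : ℕ) : ℂ) := by
  classical
  rw [Matrix.trace_diagonal, Finset.sum_boole, bss_card_sameBlock]

/-- **Frobenius norm of the block-diagonal projector**: `‖D‖_F² = K·m³`. [folklore] -/
theorem bss_frob_blockDiag {K m : ℕ} :
    (∑ r, ∑ c, ‖Matrix.diagonal (fun v : Fin (K * m) × Fin (K * m) × Fin (K * m) =>
        if (finProdFinEquiv.symm v.1).1 = (finProdFinEquiv.symm v.2.1).1 ∧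
            (finProdFinEquiv.symm v.2.1).1 = (finProdFinEquiv.symm v.2.2).1 then (1 : ℂ) else 0) r c‖ ^ 2) =
      ((K * m ^ 3 : ℕ) : ℝ) := by
  classical
  have hrow : ∀ r : Fin (K * m) × Fin (K * m) × Fin (K * m),
      (∑ c, ‖Matrix.diagonal (fun v : Fin (K * m) × Fin (K * m) × Fin (K * m) =>
        if (finProdFinEquiv.symm v.1).1 = (finProdFinEquiv.symm v.2.1).1 ∧
            (finProdFinEquiv.symm v.2.1).1 = (finProdFinEquiv.symm v.2.2).1 then (1 : ℂ) else 0) r c‖ ^ 2) =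
      if (finProdFinEquiv.symm r.1).1 = (finProdFinEquiv.symm r.2.1).1 ∧
          (finProdFinEquiv.symm r.2.1).1 = (finProdFinEquiv.symm r.2.2).1 then (1 : ℝ) else 0 := by
    intro r
    rw [Finset.sum_eq_single r]
    · rw [Matrix.diagonal_apply_eq]
      split_ifs <;> simp
    · intro c _ hc
      rw [Matrix.diagonal_apply_ne _ (Ne.symm hc)]
      simp
    · intro h
      exact absurd (Finset.mem_univ _) h
  simp_rw [hrow]
  rw [Finset.sum_boole, bss_card_sameBlock]

/-- **The block-diagonal test tensor.**  In the format `n = K·m` there is a tensor `S` (namely `♯D`, the `K` diagonal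
zero-padded copies of `⟨m,m,m⟩`) with `R(S) ≤ K·R(⟨m,m,m⟩)`, `⟨S, T_n⟩ = K·m³` and `‖S‖² = K·m³`. [folklore] -/
theorem bss_blockTensor (K m : ℕ) :
    ∃ S : (Fin (K * m) × Fin (K * m)) → (Fin (K * m) × Fin (K * m)) → (Fin (K * m) × Fin (K * m)) → ℂ,
      tensorRank S ≤ K * tensorRank (matMulTensor ℂ m m m) ∧
      (∑ a, ∑ b, ∑ c, S a b c * matMulTensor ℂ (K * m) (K * m) (K * m) a b c) = ((K * m ^ 3 : ℕ) : ℂ) ∧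
      (∑ a, ∑ b, ∑ c, ‖S a b c‖ ^ 2) = ((K * m ^ 3 : ℕ) : ℝ) := by
  refine ⟨fun a b c : Fin (K * m) × Fin (K * m) =>
    Matrix.diagonal (fun v : Fin (K * m) × Fin (K * m) × Fin (K * m) =>
      if (finProdFinEquiv.symm v.1).1 = (finProdFinEquiv.symm v.2.1).1 ∧
          (finProdFinEquiv.symm v.2.1).1 = (finProdFinEquiv.symm v.2.2).1 then (1 : ℂ) else 0)
      (a.1, b.2, c.2) (b.1, c.1, a.2), bss_tensorRank_blockDiag_le, ?_, ?_⟩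
  · rw [vrl_capture_eq_trace, bss_trace_blockDiag]
  · rw [vrl_normSq_eq, bss_frob_blockDiag]

/-! ## The dictionary -/

/-- **`R(⟨m,m,m⟩) ≤ K·m² ⟹ φ(K·m) ≥ 1/K²`, witnessed.**  If `⟨m,m,m⟩` has rank at most `K·m²` then in the format
`n = K·m` some tensor of rank `≤ n²` (the block-diagonal matrix multiplication) has `‖S‖² = K·m³` and
`|⟨S,T_n⟩|² = (K·m³)²`, i.e. it captures `K·m³ = n³/K²` of the `n³` units. [folklore] -/
theorem exists_capture_of_tensorRank_le {K m : ℕ} (hR : tensorRank (matMulTensor ℂ m m m) ≤ K * m ^ 2) :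
    ∃ S : (Fin (K * m) × Fin (K * m)) → (Fin (K * m) × Fin (K * m)) → (Fin (K * m) × Fin (K * m)) → ℂ,
      tensorRank S ≤ (K * m) ^ 2 ∧
      (∑ a, ∑ b, ∑ c, ‖S a b c‖ ^ 2) = (K : ℝ) * (m : ℝ) ^ 3 ∧
      ‖∑ a, ∑ b, ∑ c, S a b c * matMulTensor ℂ (K * m) (K * m) (K * m) a b c‖ ^ 2 =
        ((K : ℝ) * (m : ℝ) ^ 3) ^ 2 := by
  obtain ⟨S, hSr, hSo, hSn⟩ := bss_blockTensor K m
  refine ⟨S, hSr.trans ?_, ?_, ?_⟩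
  · calc K * tensorRank (matMulTensor ℂ m m m) ≤ K * (K * m ^ 2) := Nat.mul_le_mul_left _ hR
      _ = (K * m) ^ 2 := by ring
  · rw [hSn]; push_cast; ring
  · rw [hSo, Complex.norm_natCast]; push_cast; ring

/-- **Uniform capture bounds are rank lower bounds.**  If in the format `n = K·m` (`K, m ≥ 1`) every tensor of rank
`≤ n²` captures at most `c·n³` of `⟨n,n,n⟩` (`|⟨S,T_n⟩|² ≤ c·n³·‖S‖²`) with `c·K² < 1`, then `R(⟨m,m,m⟩) > K·m²`
(else the block-diagonal tensor captures `n³/K² > c·n³`).  Instances: `c < 1/4` at `n = 2m` gives `R(⟨m,m,m⟩) > 2m²`;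
`c < 1/9` at `n = 3m` gives `R(⟨m,m,m⟩) > 3m²`, beyond the printed frontier `3m² − o(m²)`. [folklore] -/
theorem tensorRank_matMul_gt_of_capture_le {K m : ℕ} {c : ℝ} (hm : 1 ≤ m) (hK : 1 ≤ K) (hc : c * (K : ℝ) ^ 2 < 1)
    (hcap : ∀ S : (Fin (K * m) × Fin (K * m)) → (Fin (K * m) × Fin (K * m)) → (Fin (K * m) × Fin (K * m)) → ℂ,
      tensorRank S ≤ (K * m) ^ 2 →
        ‖∑ a, ∑ b, ∑ c, S a b c * matMulTensor ℂ (K * m) (K * m) (K * m) a b c‖ ^ 2 ≤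
          c * ((K * m : ℕ) : ℝ) ^ 3 * ∑ a, ∑ b, ∑ c, ‖S a b c‖ ^ 2) :
    K * m ^ 2 < tensorRank (matMulTensor ℂ m m m) := by
  by_contra hle
  rw [not_lt] at hle
  obtain ⟨S, hSr, hSn, hSo⟩ := exists_capture_of_tensorRank_le hle
  have key := hcap S hSr
  rw [hSo, hSn] at key
  push_cast at key
  have hK0 : (0 : ℝ) < K := by exact_mod_cast hK
  have hm0 : (0 : ℝ) < m := by exact_mod_cast hm
  have e1 : ((K : ℝ) * (m : ℝ) ^ 3) ^ 2 = ((K : ℝ) ^ 2 * (m : ℝ) ^ 6) * 1 := by ring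
  have e2 : c * ((K : ℝ) * (m : ℝ)) ^ 3 * ((K : ℝ) * (m : ℝ) ^ 3) =
      ((K : ℝ) ^ 2 * (m : ℝ) ^ 6) * (c * (K : ℝ) ^ 2) := by ring
  rw [e1, e2] at key
  have hpos : (0 : ℝ) < (K : ℝ) ^ 2 * (m : ℝ) ^ 6 := by positivity
  have h1 : (1 : ℝ) ≤ c * (K : ℝ) ^ 2 := le_of_mul_le_mul_left key hpos
  linarith

/-- **Qualitative decay already forces superlinear rank.**  If the captured fraction at budget `n²` tends to zero —
`∀ ε > 0, ∃ N, ∀ n ≥ N, ∀ S, R(S) ≤ n² → |⟨S,T_n⟩|² ≤ ε·n³·‖S‖²` (no rate: the weakest member of the crux family) — then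
`R(⟨m,m,m⟩)/m² → ∞`: for every `K` eventually `R(⟨m,m,m⟩) > K·m²` (apply `tensorRank_matMul_gt_of_capture_le` at
`n = K·m` with `ε = 1/(2K²)`).  The conclusion is an open problem (frontier `3m² − o(m²)`), which is the price of any
decay statement at budget `n²`. [folklore] -/
theorem superlinear_tensorRank_of_qualitativeDecay
    (h : ∀ ε : ℝ, 0 < ε → ∃ N : ℕ, ∀ n : ℕ, N ≤ n →
      ∀ S : (Fin n × Fin n) → (Fin n × Fin n) → (Fin n × Fin n) → ℂ, tensorRank S ≤ n ^ 2 →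
        ‖∑ a, ∑ b, ∑ c, S a b c * matMulTensor ℂ n n n a b c‖ ^ 2 ≤
          ε * (n : ℝ) ^ 3 * ∑ a, ∑ b, ∑ c, ‖S a b c‖ ^ 2) :
    ∀ K : ℕ, ∃ M : ℕ, ∀ m : ℕ, M ≤ m → K * m ^ 2 < tensorRank (matMulTensor ℂ m m m) := by
  -- it suffices to treat `K ≥ 1`
  suffices hK1 : ∀ K : ℕ, 1 ≤ K → ∃ M : ℕ, ∀ m : ℕ, M ≤ m →
      K * m ^ 2 < tensorRank (matMulTensor ℂ m m m) by
    intro K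
    obtain ⟨M, hM⟩ := hK1 (max K 1) (le_max_right _ _)
    exact ⟨M, fun m hm => lt_of_le_of_lt (Nat.mul_le_mul_right _ (le_max_left K 1)) (hM m hm)⟩
  intro K hK
  have hK0 : (0 : ℝ) < K := by exact_mod_cast hK
  obtain ⟨N, hN⟩ := h (1 / (2 * (K : ℝ) ^ 2)) (by positivity)
  refine ⟨max N 1, fun m hm => ?_⟩
  have hm1 : 1 ≤ m := le_trans (le_max_right _ _) hm
  have hNm : N ≤ K * m := le_trans (le_trans (le_max_left _ _) hm) (Nat.le_mul_of_pos_left m hK)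
  have hc : 1 / (2 * (K : ℝ) ^ 2) * (K : ℝ) ^ 2 < 1 := by
    rw [one_div, inv_mul_eq_div, div_lt_one (by positivity)]
    nlinarith
  exact tensorRank_matMul_gt_of_capture_le hm1 hK hc (hN (K * m) hNm)

/-- **The crux implies the qualitative decay** (`C·n^{3−2δ} ≤ ε·n³` as soon as `ε·n^{2δ} ≥ C`). [folklore] -/
theorem qualitativeDecay_of_diagonalPowerDecay (hD : DiagonalPowerDecay) :
    ∀ ε : ℝ, 0 < ε → ∃ N : ℕ, ∀ n : ℕ, N ≤ n →
      ∀ S : (Fin n × Fin n) → (Fin n × Fin n) → (Fin n × Fin n) → ℂ, tensorRank S ≤ n ^ 2 →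
        ‖∑ a, ∑ b, ∑ c, S a b c * matMulTensor ℂ n n n a b c‖ ^ 2 ≤
          ε * (n : ℝ) ^ 3 * ∑ a, ∑ b, ∑ c, ‖S a b c‖ ^ 2 := by
  obtain ⟨C, δ, hδ, hB⟩ := hD
  intro ε hε
  have ht : Tendsto (fun n : ℕ => ε * (n : ℝ) ^ (2 * δ)) atTop atTop :=
    Tendsto.const_mul_atTop hε ((tendsto_rpow_atTop (by linarith)).comp tendsto_natCast_atTop_atTop)
  obtain ⟨N, hN⟩ := eventually_atTop.1 ((ht.eventually_ge_atTop C).and (eventually_ge_atTop 1))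
  refine ⟨N, fun n hn S hS => ?_⟩
  obtain ⟨hC, hn1⟩ := hN n hn
  have hn0 : (0 : ℝ) < n := by exact_mod_cast hn1
  have hsum : 0 ≤ ∑ a : Fin n × Fin n, ∑ b : Fin n × Fin n, ∑ c : Fin n × Fin n, ‖S a b c‖ ^ 2 := by
    positivity
  have hpow : 0 ≤ (n : ℝ) ^ (3 - 2 * δ) := Real.rpow_nonneg hn0.le _
  calc ‖∑ a, ∑ b, ∑ c, S a b c * matMulTensor ℂ n n n a b c‖ ^ 2
      ≤ C * (n : ℝ) ^ (3 - 2 * δ) * ∑ a, ∑ b, ∑ c, ‖S a b c‖ ^ 2 := hB n S hS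
    _ ≤ (ε * (n : ℝ) ^ (2 * δ)) * (n : ℝ) ^ (3 - 2 * δ) * ∑ a, ∑ b, ∑ c, ‖S a b c‖ ^ 2 :=
        mul_le_mul_of_nonneg_right (mul_le_mul_of_nonneg_right hC hpow) hsum
    _ = ε * (n : ℝ) ^ 3 * ∑ a, ∑ b, ∑ c, ‖S a b c‖ ^ 2 := by
        rw [mul_assoc ε, ← Real.rpow_add hn0, show 2 * δ + (3 - 2 * δ) = ((3 : ℕ) : ℝ) by norm_num,
          Real.rpow_natCast]

/-- **The crux forces superlinear rank, via the qualitative decay** — the block-self-similarity route from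
`DiagonalPowerDecay` to a rank lower bound for `⟨m,m,m⟩`, for every number of blocks `K` (the landed power-scale
consequence `dpdGlue_two_lt_omega : DiagonalPowerDecay → 2 < ω(ℂ)` is sharper; this corollary records that the
qualitative shadow of the crux alone is already summit-adjacent). [folklore] -/
theorem superlinear_tensorRank_of_diagonalPowerDecay (hD : DiagonalPowerDecay) :
    ∀ K : ℕ, ∃ M : ℕ, ∀ m : ℕ, M ≤ m → K * m ^ 2 < tensorRank (matMulTensor ℂ m m m) :=
  superlinear_tensorRank_of_qualitativeDecay (qualitativeDecay_of_diagonalPowerDecay hD)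

end Summit.MatrixMultiplication.MatrixMultiplication.Theorems.DiagonalPowerDecay
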